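import Mathlib
import Summits.ResolutionOfSingularities.ResolutionOfSingularities.Theorems.FrobeniusLadderFRationalResolutionCompletedBaseChangeFibreFlat

/-!
# Crux `FrobeniusLadder.FRationalResolution` (stmt-ResolutionOfSingularities-15317), line `redirect`,
# stub `stub_diagonalizableQuotientResolution` — the fibre engine for the LOCALIZATION `C → C_𝔮` at a maximal ideal, and the
# converse finiteness direction (toward the two-step ÉTALE descent (ε) of MEMO-15317-leafhand2-g23 §3)

`…CompletedBaseChangeFibreFlat` compares an `A`-algebra `C` with `C ⊗_A B` over `V(𝔪)` for `B` flat with `A/𝔪 ≅ B/𝔪B`; its §4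
discharges the hypotheses for `B = (T_𝔳)^`. The two-step étale descent (ε) (reading the two-step data on `Bl_𝔪(Spec 𝒪_{Y,y})`,
`𝒪_{Y,y} = C_𝔮`, and carrying them to an affine étale chart `Spec C`) needs the same for the LOCALIZATION `B = C_𝔮` at a MAXIMAL
ideal `𝔮` (`C_𝔮 = C + 𝔮C_𝔮` because `C/𝔮` is a field; `𝔮C_𝔮 ∩ C = 𝔮`; flat), and the finiteness transfer in the CONVERSE direction
(from `C ⊗_A B` down to `C`, over `V(𝔪)`), which the bijection `comap_bijOn_not_isRegularLocalRing` gives for free: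
* `forall_exists_sub_mem_localization_atPrime` — `C_𝔮 = C + 𝔮 C_𝔮` for `𝔮` maximal;
* `comap_map_le_localization_atPrime` — `𝔮 C_𝔮 ∩ C ⊆ 𝔮`;
* `flat_localization_atPrime` — `C_𝔮` is `C`-flat (Mathlib `IsLocalization.flat`, recorded in the form used here);
* ★ `finite_not_isRegularLocalRing_of_finite_baseChange` — `B` flat with `A/𝔪 ≅ B/𝔪B`, Noetherian case: if `C ⊗_A B` has finitely
  many non-regular primes over `V(𝔪)`, so has `C` (converse of `…Flat.finite_not_isRegularLocalRing_of_finite`);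
* ★★ `existsUnique_isPrime_comap_eq_localization`, `isRegularLocalRing_iff_localization`,
  `finite_not_isRegularLocalRing_of_finite_localization` — the three comparison statements for `D ⊗_C C_𝔮` versus `D` over `V(𝔮)`,
  `D` any `C`-algebra (e.g. a chart ring `C[I/a]` of `Bl_I(Spec C)`, so that `D ⊗_C C_𝔮 = C_𝔮[IC_𝔮/a]`), all hypotheses discharged.

Honest label: ring-level plumbing toward ONE leaf stub (no stub, crux or summit closed). No definitions, no named facts, no sorry.
[cite: Matsumura1987, Thm. 4.2; Thm. 8.14] [cite: StacksProject, Tag 02C5; Tag 0C4G] [folklore]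
-/

noncomputable section

-- single-problem summit: the doubled namespace component is forced
set_option linter.dupNamespace false

open IsLocalRing AlgebraicGeometry
open scoped TensorProduct
open Literature.AlgebraicGeometry.Resolution

namespace Summit.ResolutionOfSingularities.ResolutionOfSingularities.Theorems.FRationalResolution.CompletedBaseChangeFibreLocalization

/-! ## §1 The converse finiteness direction -/

variable {A B C : Type} [CommRing A] [CommRing B] [CommRing C] [Algebra A B] [Algebra A C]

/-- ★ **Finiteness of the non-regular primes over `V(𝔪)` passes DOWN from `C ⊗_A B` to `C`** (`B` flat, `A/𝔪 ≅ B/𝔪B`, Noetherian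
case): the image of a finite set under the bijection `Spec (C ⊗_A B) → Spec C` over `V(𝔪)`. [cite: Matsumura1987, Thm. 8.14] [folklore] -/
theorem finite_not_isRegularLocalRing_of_finite_baseChange [Module.Flat A B] [IsNoetherianRing C]
    [IsNoetherianRing (C ⊗[A] B)] (𝔪 : Ideal A)
    (hres : ∀ b : B, ∃ a : A, b - algebraMap A B a ∈ 𝔪.map (algebraMap A B))
    (hinj : (𝔪.map (algebraMap A B)).comap (algebraMap A B) ≤ 𝔪)
    (hfin : {𝔑 : PrimeSpectrum (C ⊗[A] B) | 𝔪.map (algebraMap A C) ≤ 𝔑.asIdeal.comap (algebraMap C (C ⊗[A] B)) ∧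
      ¬ IsRegularLocalRing (Localization.AtPrime 𝔑.asIdeal)}.Finite) :
    {𝔫 : PrimeSpectrum C | 𝔪.map (algebraMap A C) ≤ 𝔫.asIdeal ∧
      ¬ IsRegularLocalRing (Localization.AtPrime 𝔫.asIdeal)}.Finite := by
  have hbij := CompletedBaseChangeFibreFlat.comap_bijOn_not_isRegularLocalRing (B := B) (C := C) 𝔪 hres hinj
  rw [← hbij.image_eq]
  exact hfin.image _

/-! ## §2 The localization `C → C_𝔮` at a maximal ideal -/

section Localization

variable (C : Type) [CommRing C] (𝔮 : Ideal C) [h𝔮 : 𝔮.IsMaximal]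

/-- `C_𝔮 = C + 𝔮 C_𝔮` for `𝔮` MAXIMAL (`C/𝔮` is the residue field of `C_𝔮`). [cite: StacksProject, Tag 02C5] [folklore] -/
theorem forall_exists_sub_mem_localization_atPrime :
    ∀ b : Localization.AtPrime 𝔮, ∃ c : C,
      b - algebraMap C (Localization.AtPrime 𝔮) c ∈ 𝔮.map (algebraMap C (Localization.AtPrime 𝔮)) := by
  intro b
  rw [Localization.AtPrime.map_eq_maximalIdeal]
  obtain ⟨c, hc⟩ := CompletionOfFlatUnramifiedAtPrime.forall_exists_sub_localRingHom_mem 𝔮 𝔮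
    (show 𝔮.comap (algebraMap C C) = 𝔮 from Ideal.comap_id 𝔮) (fun x => ⟨x, by simp⟩) b
  -- `c ∈ C_𝔮`; replace it by its residue representative in `C`
  obtain ⟨t, ht⟩ := Ideal.Quotient.mk_surjective
    ((IsLocalization.AtPrime.equivQuotMaximalIdeal 𝔮 (Localization.AtPrime 𝔮)).symm (Ideal.Quotient.mk _ c))
  have hmk : Ideal.Quotient.mk (maximalIdeal (Localization.AtPrime 𝔮)) (algebraMap C (Localization.AtPrime 𝔮) t) =
      Ideal.Quotient.mk _ c := by
    rw [← IsLocalization.AtPrime.equivQuotMaximalIdeal_apply_mk 𝔮 (Localization.AtPrime 𝔮), ht, RingEquiv.apply_symm_apply]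
  have h1 : c - algebraMap C (Localization.AtPrime 𝔮) t ∈ maximalIdeal (Localization.AtPrime 𝔮) := by
    rw [← Ideal.Quotient.eq, hmk]
  refine ⟨t, ?_⟩
  have h2 : Localization.localRingHom 𝔮 𝔮 (algebraMap C C) (show 𝔮 = 𝔮.comap (algebraMap C C) from
      (Ideal.comap_id 𝔮).symm) c = c := by
    obtain ⟨⟨r, s⟩, rfl⟩ := IsLocalization.mk'_surjective 𝔮.primeCompl c
    rw [Localization.localRingHom_mk']
    rfl
  rw [h2] at hc
  have := Ideal.add_mem _ hc h1
  rwa [sub_add_sub_cancel] at this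

/-- `𝔮 C_𝔮 ∩ C ⊆ 𝔮`. [folklore] -/
theorem comap_map_le_localization_atPrime :
    (𝔮.map (algebraMap C (Localization.AtPrime 𝔮))).comap (algebraMap C (Localization.AtPrime 𝔮)) ≤ 𝔮 := by
  rw [Localization.AtPrime.map_eq_maximalIdeal]
  intro c hc
  rw [Ideal.mem_comap] at hc
  exact (IsLocalization.AtPrime.to_map_mem_maximal_iff (Localization.AtPrime 𝔮) 𝔮 c).mp hc

/-- `C_𝔮` is flat over `C`. [cite: Matsumura1987, Thm. 4.2] -/
theorem flat_localization_atPrime : Module.Flat C (Localization.AtPrime 𝔮) :=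
  IsLocalization.flat (Localization.AtPrime 𝔮) 𝔮.primeCompl

variable (D : Type) [CommRing D] [Algebra C D]

/-- ★★ **Points**: for a `C`-algebra `D` and a prime `𝔫 ⊇ 𝔮D` there is exactly one prime of `D ⊗_C C_𝔮` over `𝔫`.
[cite: StacksProject, Tag 0C4G] [folklore] -/
theorem existsUnique_isPrime_comap_eq_localization (𝔫 : Ideal D) [𝔫.IsPrime] (h𝔫 : 𝔮.map (algebraMap C D) ≤ 𝔫) :
    ∃! 𝔑 : Ideal (D ⊗[C] Localization.AtPrime 𝔮), 𝔑.IsPrime ∧ 𝔑.comap (algebraMap D _) = 𝔫 :=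
  CompletedBaseChangeFibreFlat.existsUnique_isPrime_comap_eq 𝔮 (forall_exists_sub_mem_localization_atPrime C 𝔮)
    (comap_map_le_localization_atPrime C 𝔮) 𝔫 h𝔫

/-- ★★ **Regularity**: for a prime `𝔑` of `D ⊗_C C_𝔮` over `𝔫 ⊇ 𝔮D` (`D`, `D ⊗_C C_𝔮` Noetherian), `D_𝔫` is regular iff
`(D ⊗_C C_𝔮)_𝔑` is. [cite: Matsumura1987, Thm. 8.14] [folklore] -/
theorem isRegularLocalRing_iff_localization [IsNoetherianRing D] [IsNoetherianRing (D ⊗[C] Localization.AtPrime 𝔮)]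
    (𝔫 : Ideal D) [𝔫.IsPrime] (h𝔫 : 𝔮.map (algebraMap C D) ≤ 𝔫)
    (𝔑 : Ideal (D ⊗[C] Localization.AtPrime 𝔮)) [𝔑.IsPrime] (h𝔑 : 𝔑.comap (algebraMap D _) = 𝔫) :
    IsRegularLocalRing (Localization.AtPrime 𝔫) ↔ IsRegularLocalRing (Localization.AtPrime 𝔑) := by
  haveI := flat_localization_atPrime C 𝔮
  exact CompletedBaseChangeFibreFlat.isRegularLocalRing_iff 𝔮 (forall_exists_sub_mem_localization_atPrime C 𝔮) 𝔫 h𝔫 𝔑 h𝔑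

/-- ★★ **Finiteness, downwards**: if `D ⊗_C C_𝔮` has finitely many non-regular primes over `V(𝔮)`, so has `D`
(`D`, `D ⊗_C C_𝔮` Noetherian). [cite: Matsumura1987, Thm. 8.14] [folklore] -/
theorem finite_not_isRegularLocalRing_of_finite_localization [IsNoetherianRing D]
    [IsNoetherianRing (D ⊗[C] Localization.AtPrime 𝔮)]
    (hfin : {𝔑 : PrimeSpectrum (D ⊗[C] Localization.AtPrime 𝔮) |
      𝔮.map (algebraMap C D) ≤ 𝔑.asIdeal.comap (algebraMap D (D ⊗[C] Localization.AtPrime 𝔮)) ∧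
      ¬ IsRegularLocalRing (Localization.AtPrime 𝔑.asIdeal)}.Finite) :
    {𝔫 : PrimeSpectrum D | 𝔮.map (algebraMap C D) ≤ 𝔫.asIdeal ∧
      ¬ IsRegularLocalRing (Localization.AtPrime 𝔫.asIdeal)}.Finite := by
  haveI := flat_localization_atPrime C 𝔮
  exact finite_not_isRegularLocalRing_of_finite_baseChange 𝔮 (forall_exists_sub_mem_localization_atPrime C 𝔮)
    (comap_map_le_localization_atPrime C 𝔮) hfin

end Localization

end Summit.ResolutionOfSingularities.ResolutionOfSingularities.Theorems.FRationalResolution.CompletedBaseChangeFibreLocalization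

end
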